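import Summits.CriticalPhenomena.PercolationContinuityZ3.Theorems.Transplant.FKConnectivityAllQTwoTree
import Summits.CriticalPhenomena.PercolationContinuityZ3.Theorems.Transplant.FKConnectivityAllQSeriesParallel
import Summits.CriticalPhenomena.PercolationContinuityZ3.Theorems.Transplant.FKConnectivityAllQLoops
import Summits.CriticalPhenomena.PercolationContinuityZ3.Theorems.Transplant.K4MinorFreeDirac
import Literature.Probability.LatticeModels.RandomClusterRayleighSeriesParallel
import HarnessLib

/-!
# Connectivity correlation inequalities for `φ_{w,q}`, every `q > 0` — Wagner's theorem (graph case) DISCHARGED: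
# `φ_{w,q}`, `0 < q ≤ 1`, is edge-negatively associated on every weighted graph without a `K₄` minor

Support file (`--supports stmt-CriticalPhenomena-4575`), FK sub-lane `prim-bschramm-fk-3` (gen 6) of the post-continuity
programme; builds on p205010 (kernel theorem, internal audit signed; external expert review pending).  No definitions, no named
facts as hypotheses, no sorries; standard axioms.

`Wagner2008_rc_edgeNegCorr_of_noK4Minor_holds : Wagner2008_rc_edgeNegCorr_of_noK4Minor` — the Literature named fact
(Wagner, Ann. Comb. 12 (2008), graph case in negative-correlation form: for `0 < q ≤ 1` and every weight vector on `Fin n` whose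
support graph has no `K₄` minor, `φ_{w,q}(J_e ∩ J_f) ≤ φ_{w,q}(J_e)·φ_{w,q}(J_f)` for all pairs `f ≠ e`, `e` not a loop) is now a
THEOREM of the tree.  Assembly of three kernel ingredients:
1. fk-1 (gen 5): `FK.edgeNegCorrSupp_of_isTwoTree` — negative edge correlation for every weight vector supported inside a
   2-tree (apex elimination; a vertex-level form of Wagner's two-sum induction, Thm. 5.8(d));
2. this seat: `K4Free.exists_superset_of_not_hasK4Minor` (`…K4MinorFreeDirac.lean`) — the graph theory: a finite graph without
   a `K₄` minor (branch sets) lies inside a 2-tree (Dirac 1952 / Duffin 1965; rotation-descent proof of Dirac's lemma);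
3. this seat: loop erasure (`…AllQLoops.lean`) — the named fact's support GRAPH ignores diagonal pairs, which are independent coins.
Consequence: fk-2's `FK.pairConnPosUnder_of_noK4Minor` / `FK.hubUnder_of_noK4Minor` (Ayyer–Linusson–Ravichandran's hub
inequality (13) on series–parallel supports, every `q ∈ (0,1)`) hold with their named-fact hypothesis discharged:
`FK.pairConnPosUnder_of_noK4Minor'`, `FK.hubUnder_of_noK4Minor'`.
[cite: Wagner2006, Ex. 5.1, Thm. 5.8(d), §5.2, §5.3] [cite: Diestel2017, §7.3 (Prop. 7.3.1, Cor. 7.3.2)]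
[cite: Grimmett2006, §3.9 eq. (3.94) (p. 63); §1.4 eq. (1.20) (p. 15)] [cite: AyyerLinussonRavichandran2025, §7 eq. (13) (p. 22)]
-/

noncomputable section

namespace Summit.CriticalPhenomena.PercolationContinuityZ3.Theorems

namespace FK

open MeasureTheory Set Literature.Probability.LatticeModels Literature.Probability.Percolation
open scoped Classical

/-- **Every `K₄`-minor-free graph on `Fin n` (`n ≥ 2`) lies inside a 2-tree**: there is `T` with `IsTwoTree T` containing every
edge of `G` as a pair. [cite: Diestel2017, §7.3 (Prop. 7.3.1, Cor. 7.3.2)] -/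
theorem exists_isTwoTree_superset_of_not_hasK4Minor {V : Type*} [Fintype V] (G : SimpleGraph V) (hK : ¬ HasK4Minor G)
    (hV : 1 < Fintype.card V) :
    ∃ T : Set (Sym2 V), IsTwoTree T ∧ ∀ a b, G.Adj a b → s(a, b) ∈ T := by
  classical
  have hcard : (Finset.univ : Finset V).card = (Fintype.card V - 2) + 2 := by
    rw [Finset.card_univ]; omega
  obtain ⟨T, hT, hedges, -, -, -⟩ := K4Free.exists_superset_of_not_hasK4Minor (V := V) IsTwoTree
    (fun u v huv => IsTwoTree.pair huv)
    (fun T u v x hT huv hx => IsTwoTree.cons hT huv hx)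
    (Fintype.card V - 2) Finset.univ G hcard hK (fun a b _ => ⟨Finset.mem_univ a, Finset.mem_univ b⟩)
  exact ⟨T, hT, hedges⟩

/-- **Wagner 2008 (graph case), DISCHARGED**: for `0 < q ≤ 1` the random-cluster measure `φ_{w,q}` is edge-negatively
associated on every weighted graph whose support has no `K₄` minor.  [cite: Wagner2006, Ex. 5.1, Thm. 5.8(d), §5.2, §5.3]
[cite: Grimmett2006, §3.9 eq. (3.94) (p. 63)] [cite: Diestel2017, §7.3 (Prop. 7.3.1, Cor. 7.3.2)] -/
theorem Wagner2008_rc_edgeNegCorr_of_noK4Minor_holds : Wagner2008_rc_edgeNegCorr_of_noK4Minor := by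
  intro n w q hq0 hq1 hK e f he hfe
  by_cases hf : f.IsDiag
  · -- `f` is a loop: an independent coin, equality
    induction f using Sym2.ind with
    | h x y =>
      have hxy : x = y := Sym2.mk_isDiag_iff.1 hf
      subst hxy
      have hne : e ≠ s(x, x) := fun h => he (h ▸ Sym2.mk_isDiag_iff.2 rfl)
      rw [rcMeasureW_real_inter_loop w hq0 x hne]
  · -- both pairs nondiagonal: erase the loops and embed the support into a 2-tree
    rw [rcMeasureW_real_eraseLoops w hq0 _ (openPair_inter_loop_insensitive he hf),
      rcMeasureW_real_eraseLoops w hq0 _ (openPair_loop_insensitive he),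
      rcMeasureW_real_eraseLoops w hq0 _ (openPair_loop_insensitive hf)]
    -- `Fin n` has two elements (the ends of `e`)
    have hn : 1 < Fintype.card (Fin n) := by
      induction e using Sym2.ind with
      | h a b => exact Fintype.one_lt_card_iff.2 ⟨a, b, fun h => he (Sym2.mk_isDiag_iff.2 h)⟩
    obtain ⟨T, hT, hedges⟩ := exists_isTwoTree_superset_of_not_hasK4Minor _ hK hn
    refine edgeNegCorrSupp_of_isTwoTree hq0 hq1 hT _ (fun g hg => ?_) e f he hfe
    by_cases hgd : g.IsDiag
    · exact (hg (by rw [if_pos hgd]; rfl)).elim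
    · rw [if_neg hgd] at hg
      induction g using Sym2.ind with
      | h a b =>
        exact hedges a b ((SimpleGraph.fromEdgeSet_adj _).2 ⟨hg, fun h => hgd (Sym2.mk_isDiag_iff.2 h)⟩)

/-- **Pairwise positive correlation of connection events on `K₄`-minor-free supports, every `q ∈ (0,1)` — UNCONDITIONAL**
(fk-2's `pairConnPosUnder_of_noK4Minor` with Wagner's theorem discharged). [cite: Wagner2006, Thm. 5.8(d), §5.3]
[cite: AyyerLinussonRavichandran2025, §7 eq. (13)–(15) (p. 22)] -/
theorem pairConnPosUnder_of_noK4Minor' {q : ℝ} (hq0 : 0 < q) (hq1 : q < 1) {n : ℕ} (w : Sym2 (Fin n) → unitInterval)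
    (x y u v : Fin n)
    (hG : ¬ HasK4Minor (SimpleGraph.fromEdgeSet
      ({e : Sym2 (Fin n) | ((w e : unitInterval) : ℝ) ≠ 0} ∪ {s(x, y), s(u, v)}))) :
    PairConnPosUnder (rcMeasureW w q ∅) x y u v :=
  pairConnPosUnder_of_noK4Minor Wagner2008_rc_edgeNegCorr_of_noK4Minor_holds hq0 hq1 w x y u v hG

/-- **The hub inequality on series–parallel supports, every `q ∈ (0,1)` — UNCONDITIONAL** (Ayyer–Linusson–Ravichandran 2025
(13) along every `K₄`-minor-free `supp(w) ∪ {oa, ba}`). [cite: AyyerLinussonRavichandran2025, §7 eq. (13), Conj. 7.1 (p. 22)]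
[cite: Wagner2006, Thm. 5.8(d), §5.3] -/
theorem hubUnder_of_noK4Minor' {q : ℝ} (hq0 : 0 < q) (hq1 : q < 1) {n : ℕ} (w : Sym2 (Fin n) → unitInterval) (o a b : Fin n)
    (hG : ¬ HasK4Minor (SimpleGraph.fromEdgeSet
      ({e : Sym2 (Fin n) | ((w e : unitInterval) : ℝ) ≠ 0} ∪ {s(o, a), s(b, a)}))) :
    HubUnder (rcMeasureW w q ∅) o a b :=
  hubUnder_of_noK4Minor Wagner2008_rc_edgeNegCorr_of_noK4Minor_holds hq0 hq1 w o a b hG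

end FK

end Summit.CriticalPhenomena.PercolationContinuityZ3.Theorems

end
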